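import Summits.ABC.StewartYu.PadicG3ParVA
import Summits.ABC.StewartYu.PadicG3ParGB
import HarnessLib

/-!
# Cell abc-stewartyu, Gen-3 record v2 (WP-M3.R, m = 0 branch): scalar facts of the corrected family `PadicG3ParV`
# for the record BY NAME — the effective range `⌈g⌉·XV`, the END degree scale, `LgV = O(K·Ω)`, the END range slot

`Summits/ABC/StewartYu/RecordByNameVPrep.lean` — cell `abc-stewartyu` (HOME `run/shared/lean/pub/abc-stewartyu/`),
route `PadicPrimesKummerThird`, crux `Y07Odd` (stmt-ABC-19658), registered stub `stub_endRecordG` (record half);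
seat lp-1 (g3).  Theorems only; consumed by `RecordByNameV` (the ONE application of
`RecordExitsNumeric.recordOdd_of_facts`, p490748, to `PadicG3ParV`, p491605/p492021).

* `⌈g⌉`: `1 ≤ ⌈g⌉`, `g ≤ ⌈g⌉ ≤ 2^{lgg}`, `⌈g⌉ < g + 1`, `lgg ≤ ⌈g⌉`; depth `ŜG = Ŝ + lgg`, so
  `2^{Ŝ−1}·⌈g⌉ ≤ 2^{ŜG−1}` and `2^{n+22}·⌈g⌉ ≤ 2^{ŜG−2}` — the depth's `2^{lgg}` pays for the excess-gain factor of
  the effective level-0 range `X := ⌈g⌉·XV` (needed because `D₀V ≤ g·XV·LgV/4 + 2`);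
* `2^{ŜG−1}·XV < XsV ŜG`, hence the range facts `2^{n+22}·X ≤ X_f`, `2^{Ŝ−1}·X < 2X_f + 1` whenever
  `XsV ŜG ≤ 2X_f + 1` (`range_facts`);
* END degree scale `ρ₀ = N_q·LV/2^{ŜG} < LgV/2^{n+23}` and `DV j ≤ ρ₀/Aⱼ + 1`;
* `LgV ≤ (264·C_bⁿ + 2^{2n+26})·K·Ω` under the convention facts and `g ≤ K` (clause (C)'s `hLKΩ`);
* the frame's END range slot: `XsV ŜG ≤ 2·⌊2ⁿ·XsV ŜG/(2(n+1))⌋ + 1` and `2(n+1)·⌊2ⁿ·XsV ŜG/(2(n+1))⌋ ≤ 2ⁿ·XsV ŜG`.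

References: Yu. V. Nesterenko, LNM 1819 (2003), §3.5 (3.23), §5.2 (5.12)–(5.17); K. Yu, Acta Math. 211 (2013), §3.1.
-/

noncomputable section

open Finset Real Nat

namespace Summit.ABC.StewartYu

namespace PadicG3Par

variable {n : ℕ} (P : PadicG3Par n)

/-! ### The excess-gain ceiling `⌈g⌉` and the depth -/

/-- `1 ≤ ⌈g⌉`. [folklore] -/
theorem one_le_gceil : 1 ≤ P.gceil := by
  unfold gceil
  exact Nat.ceil_pos.mpr (lt_of_lt_of_le one_pos P.one_le_g)

/-- `g ≤ ⌈g⌉`. [folklore] -/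
theorem g_le_gceil : P.g ≤ P.gceil := by unfold gceil; exact Nat.le_ceil _

/-- `⌈g⌉ ≤ 2^{lgg}`. [folklore] -/
theorem gceil_le_two_pow_lgg : P.gceil ≤ 2 ^ P.lgg := by
  unfold lgg; exact Nat.le_pow_clog (by norm_num) _

/-- `⌈g⌉ < g + 1`. [folklore] -/
theorem gceil_lt : (P.gceil : ℝ) < P.g + 1 := by
  unfold gceil; exact Nat.ceil_lt_add_one (lt_of_lt_of_le one_pos P.one_le_g).le

/-- `lgg ≤ ⌈g⌉`. [folklore] -/
theorem lgg_le_gceil : P.lgg ≤ P.gceil := by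
  unfold lgg
  exact (Nat.clog_le_iff_le_pow (by norm_num)).mpr (Nat.lt_two_pow_self).le

/-- `ŜG = Ŝ + lgg`. [folklore] -/
theorem SdG_eq : P.SdG = P.Sdepth + P.lgg := by unfold SdG Sdepth; ring

/-- `n + 24 ≤ Ŝ`. [folklore] -/
theorem le_Sdepth : n + 24 ≤ P.Sdepth := by unfold Sdepth; omega

/-- `2^{Ŝ−1}·⌈g⌉ ≤ 2^{ŜG−1}` (the depth's `2^{lgg}` absorbs `⌈g⌉`). [folklore] -/
theorem two_pow_Sdepth_pred_mul_gceil_le : 2 ^ (P.Sdepth - 1) * P.gceil ≤ 2 ^ (P.SdG - 1) := by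
  have h1 := P.gceil_le_two_pow_lgg
  have hS := P.le_Sdepth
  have e : P.SdG - 1 = (P.Sdepth - 1) + P.lgg := by rw [P.SdG_eq]; omega
  calc 2 ^ (P.Sdepth - 1) * P.gceil ≤ 2 ^ (P.Sdepth - 1) * 2 ^ P.lgg := Nat.mul_le_mul_left _ h1
    _ = 2 ^ ((P.Sdepth - 1) + P.lgg) := (pow_add 2 _ _).symm
    _ = 2 ^ (P.SdG - 1) := by rw [e]

/-- `2^{n+22}·⌈g⌉ ≤ 2^{ŜG−2}`. [folklore] -/
theorem two_pow_mul_gceil_le : 2 ^ (n + 22) * P.gceil ≤ 2 ^ (P.SdG - 2) := by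
  have h1 := P.gceil_le_two_pow_lgg
  have hS := P.le_Sdepth
  have e : P.SdG - 2 = (P.Sdepth - 2) + P.lgg := by rw [P.SdG_eq]; omega
  have h2 : 2 ^ (n + 22) ≤ 2 ^ (P.Sdepth - 2) := Nat.pow_le_pow_right (by norm_num) (by omega)
  calc 2 ^ (n + 22) * P.gceil ≤ 2 ^ (P.Sdepth - 2) * 2 ^ P.lgg := Nat.mul_le_mul h2 h1
    _ = 2 ^ ((P.Sdepth - 2) + P.lgg) := (pow_add 2 _ _).symm
    _ = 2 ^ (P.SdG - 2) := by rw [e]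

/-- **`2^{ŜG−1}·XV < XsV ŜG`** (`XsV ŜG > 2^{ŜG−1}·g·XV`, `g ≥ 1`). [cite: Nesterenko2003, §5.2 (5.12)] -/
theorem two_pow_mul_XV_lt_XsV : 2 ^ (P.SdG - 1) * P.XV < P.XsV P.SdG := by
  have h := P.XsV_gt P.SdG
  have hg := P.one_le_g
  have hX : (0 : ℝ) ≤ P.XV := by positivity
  obtain ⟨k, hk⟩ : ∃ k, P.SdG = k + 1 := ⟨P.SdG - 1, by have := P.le_Sdepth; rw [P.SdG_eq]; omega⟩
  rw [hk, Nat.add_sub_cancel]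
  rw [hk] at h
  have e : (2 : ℝ) ^ (k + 1) * P.g * P.XV / 2 = 2 ^ k * P.XV * P.g := by rw [pow_succ]; ring
  rw [e] at h
  have h0 : (0 : ℝ) ≤ 2 ^ k * P.XV := by positivity
  have h1 : (2 : ℝ) ^ k * P.XV ≤ 2 ^ k * P.XV * P.g := le_mul_of_one_le_right h0 hg
  have h3 : (2 : ℝ) ^ k * P.XV < P.XsV (k + 1) := lt_of_le_of_lt h1 h
  exact_mod_cast h3

/-- **The range facts of the effective range `⌈g⌉·XV`**: if `XsV ŜG ≤ 2·X_f + 1` then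
`2^{n+22}·(⌈g⌉·XV) ≤ X_f` and `2^{Ŝ−1}·(⌈g⌉·XV) < 2·X_f + 1`. [cite: Nesterenko2003, §5.2 (5.12)] -/
theorem range_facts {Xf : ℕ} (hXf : P.XsV P.SdG ≤ 2 * Xf + 1) :
    2 ^ (n + 22) * (P.gceil * P.XV) ≤ Xf ∧ 2 ^ (P.Sdepth - 1) * (P.gceil * P.XV) < 2 * Xf + 1 := by
  have h1 := P.two_pow_mul_XV_lt_XsV
  have h2 := P.two_pow_Sdepth_pred_mul_gceil_le
  have h3 := P.two_pow_mul_gceil_le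
  have hS : 2 ≤ P.SdG := by have := P.le_Sdepth; rw [P.SdG_eq]; omega
  have e : 2 ^ (P.SdG - 1) = 2 ^ (P.SdG - 2) * 2 := by
    rw [← pow_succ]; congr 1; omega
  refine ⟨?_, ?_⟩
  · -- `2·(2^{n+22}⌈g⌉XV) ≤ 2·2^{ŜG-2}·XV = 2^{ŜG-1}XV < XsV ≤ 2X_f+1`
    have h4 : 2 ^ (n + 22) * (P.gceil * P.XV) ≤ 2 ^ (P.SdG - 2) * P.XV := by
      rw [← mul_assoc]; exact Nat.mul_le_mul_right _ h3
    have h5 : 2 * (2 ^ (P.SdG - 2) * P.XV) < 2 * Xf + 1 := by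
      calc 2 * (2 ^ (P.SdG - 2) * P.XV) = 2 ^ (P.SdG - 2) * 2 * P.XV := by ring
        _ = 2 ^ (P.SdG - 1) * P.XV := by rw [e]
        _ < P.XsV P.SdG := h1
        _ ≤ 2 * Xf + 1 := hXf
    omega
  · calc 2 ^ (P.Sdepth - 1) * (P.gceil * P.XV) = 2 ^ (P.Sdepth - 1) * P.gceil * P.XV := by ring
      _ ≤ 2 ^ (P.SdG - 1) * P.XV := Nat.mul_le_mul_right _ h2
      _ < P.XsV P.SdG := h1
      _ ≤ 2 * Xf + 1 := hXf

/-! ### The END degree scale `ρ₀ = N_q LV/2^{ŜG}` -/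

/-- `N_q·LV/2^{ŜG} < LgV/2^{n+23}` (`2^{ŜG} > 2^{n+23}·N_q·2^{lgg}`, `LV ≤ g·LgV ≤ 2^{lgg}·LgV`).
[cite: Nesterenko2003, §5.2 (5.17)] -/
theorem rhoV_lt : (P.Nq : ℝ) * P.LV / 2 ^ P.SdG < (P.LgV : ℝ) / 2 ^ (n + 23) := by
  have hS : (2 : ℝ) ^ (n + 23) * P.Nq * 2 ^ P.lgg < 2 ^ P.SdG := by exact_mod_cast P.lt_two_pow_SdG
  have hNq : (0 : ℝ) < P.Nq := by exact_mod_cast P.hNq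
  have hL : (0 : ℝ) < P.LgV := by linarith [P.one_le_LgV]
  have hLV : (P.LV : ℝ) ≤ 2 ^ P.lgg * P.LgV :=
    calc (P.LV : ℝ) ≤ P.g * P.LgV := P.LV_le_g_mul_LgV
      _ ≤ 2 ^ P.lgg * P.LgV := mul_le_mul_of_nonneg_right P.g_le_two_pow_lgg hL.le
  rw [div_lt_div_iff₀ (by positivity) (by positivity)]
  calc (P.Nq : ℝ) * P.LV * 2 ^ (n + 23) ≤ P.Nq * (2 ^ P.lgg * P.LgV) * 2 ^ (n + 23) := by gcongr
    _ = P.LgV * (2 ^ (n + 23) * P.Nq * 2 ^ P.lgg) := by ring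
    _ < P.LgV * 2 ^ P.SdG := mul_lt_mul_of_pos_left hS hL

/-- `DV j ≤ (N_q·LV/2^{ŜG})/Aⱼ + 1`. [cite: Nesterenko2003, §5.2 (5.17)] -/
theorem DV_le_rhoV_div (j : Fin n) : (P.DV j : ℝ) ≤ (P.Nq : ℝ) * P.LV / 2 ^ P.SdG / P.A j + 1 := by
  have hA := P.A_pos j
  have h0 : 0 ≤ (P.Nq : ℝ) * P.LV / (2 ^ P.SdG * P.A j) := by positivity
  unfold DV; push_cast
  have h1 := Nat.floor_le h0
  rw [div_div]
  linarith

/-- `1 ≤ DV j`. [folklore] -/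
theorem one_le_DV (j : Fin n) : 1 ≤ P.DV j := by unfold DV; omega

/-- `1 ≤ D₀V`. [folklore] -/
theorem one_le_D0V : 1 ≤ P.D0V := by unfold D0V; omega

/-! ### The multiplicity scale is `O(K·Ω)` -/

/-- `ŜG + 2 ≤ n + 27 + 2ⁿ·K + K` under `N_q ≤ 2ⁿK` and `g ≤ K`
(`⌊log₂ N_q⌋ < N_q`, `lgg ≤ ⌈g⌉ < g + 1`). [folklore] -/
theorem SdG_add_two_le (hNqK : P.Nq ≤ 2 ^ n * P.K) (hgK : P.g ≤ (P.K : ℝ)) :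
    P.SdG + 2 ≤ n + 27 + 2 ^ n * P.K + P.K := by
  have h1 : Nat.log 2 P.Nq < P.Nq :=
    lt_of_lt_of_le Nat.lt_two_pow_self (Nat.pow_log_le_self 2 (by have := P.hNq; omega))
  have h2 := P.lgg_le_gceil
  have h3 : P.gceil ≤ P.K + 1 := by
    have h := P.gceil_lt
    have h' : (P.gceil : ℝ) < (P.K : ℝ) + 1 := by linarith
    have h'' : P.gceil < P.K + 1 := by exact_mod_cast h'
    omega
  unfold SdG; omega

/-- `4(ŜG + 2) ≤ 2^{n+8}·K` under `N_q ≤ 2ⁿK` and `g ≤ K`. [folklore] -/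
theorem four_SdG_le_pow_mul_K (hNqK : P.Nq ≤ 2 ^ n * P.K) (hgK : P.g ≤ (P.K : ℝ)) :
    4 * (P.SdG + 2) ≤ 2 ^ (n + 8) * P.K := by
  have h1 := P.SdG_add_two_le hNqK hgK
  have hK := P.one_le_K
  have h2n : n + 1 ≤ 2 ^ n := Nat.succ_le_of_lt Nat.lt_two_pow_self
  -- `4n + 108 ≤ 128·(n+1) ≤ 2^{n+7}`, `2^{n+2} + 4 ≤ 2^{n+7}`
  have e8 : 2 ^ (n + 8) = 128 * 2 ^ n + 128 * 2 ^ n := by rw [pow_add]; ring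
  have e2 : 2 ^ (n + 2) = 4 * 2 ^ n := by rw [pow_add]; ring
  have h3 : 4 * (P.SdG + 2) ≤ 4 * (n + 27) + 4 * 2 ^ n * P.K + 4 * P.K := by
    calc 4 * (P.SdG + 2) ≤ 4 * (n + 27 + 2 ^ n * P.K + P.K) := Nat.mul_le_mul_left 4 h1
      _ = 4 * (n + 27) + 4 * 2 ^ n * P.K + 4 * P.K := by ring
  have h4 : 4 * (n + 27) ≤ 128 * 2 ^ n := by omega
  have h5 : 128 * 2 ^ n ≤ 128 * 2 ^ n * P.K := Nat.le_mul_of_pos_right _ (by omega)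
  have h6 : 4 * 2 ^ n * P.K + 4 * P.K ≤ 128 * 2 ^ n * P.K := by
    have h7 : 4 * 2 ^ n + 4 ≤ 128 * 2 ^ n := by have := Nat.one_le_two_pow (n := n); omega
    calc 4 * 2 ^ n * P.K + 4 * P.K = (4 * 2 ^ n + 4) * P.K := by ring
      _ ≤ (128 * 2 ^ n) * P.K := Nat.mul_le_mul_right _ h7
  calc 4 * (P.SdG + 2) ≤ 4 * (n + 27) + 4 * 2 ^ n * P.K + 4 * P.K := h3
    _ ≤ 128 * 2 ^ n * P.K + 128 * 2 ^ n * P.K := by omega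
    _ = 2 ^ (n + 8) * P.K := by rw [e8]; ring

/-- **`LgV ≤ (264·C_bⁿ + 2^{2n+26})·K·Ω`** under the convention facts (`½ ≤ θ₀`, `N_q ≤ 2ⁿK`, `Amax ≤ 2ⁿΩ`,
`1 ≤ Aⱼ`) and `g ≤ K`: the four branches `⌈24 C_bⁿΩK·yloadG/(G gⁿ)⌉ ≤ 264 C_bⁿΩK + 1` (`yloadG ≤ 11 G`),
`2^{n+25}`, `⌈(2Amax+1)/g⌉ ≤ 2^{n+1}Ω + 2`, `4(ŜG+2) ≤ 2^{n+8}·K`. [cite: Nesterenko2003, §3.5 (3.23)] -/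
theorem LgV_le_KΩ (hθ : (1 / 2 : ℝ) ≤ P.θ₀) (hNqK : P.Nq ≤ 2 ^ n * P.K) (hAmax : P.Amax ≤ 2 ^ n * P.Ω)
    (hA1 : ∀ j, 1 ≤ P.A j) (hgK : P.g ≤ (P.K : ℝ)) :
    (P.LgV : ℝ) ≤ (264 * Cb ^ n + 2 ^ (2 * n + 26)) * P.K * P.Ω := by
  have hG : 0 < P.G := by linarith [P.eight_le_G]
  have hy := P.yloadG_le_eleven_G hθ hNqK
  have hK1 : (1 : ℝ) ≤ P.K := by exact_mod_cast P.one_le_K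
  have hΩ1 : (1 : ℝ) ≤ P.Ω := by
    unfold Ω
    calc (1 : ℝ) = ∏ _j : Fin n, (1 : ℝ) := by simp
      _ ≤ ∏ j, P.A j := prod_le_prod (fun _ _ => zero_le_one) fun j _ => hA1 j
  have hCb : (0 : ℝ) < Cb ^ n := by have := sixtyfour_le_Cb; positivity
  have hΩ := P.Ω_pos
  have hg1 := P.one_le_g
  have hgn : 1 ≤ P.g ^ n := one_le_pow₀ hg1
  have hKΩ : (1 : ℝ) ≤ P.K * P.Ω := one_le_mul_of_one_le_of_one_le hK1 hΩ1
  have h226 : (1 : ℝ) ≤ 2 ^ (2 * n + 26) := one_le_pow₀ (by norm_num)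
  have hbig : (1 : ℝ) ≤ 2 ^ (2 * n + 26) * P.K * P.Ω :=
    one_le_mul_of_one_le_of_one_le (one_le_mul_of_one_le_of_one_le h226 hK1) hΩ1
  have eR : (264 * Cb ^ n + 2 ^ (2 * n + 26)) * P.K * P.Ω =
      264 * Cb ^ n * P.Ω * P.K + 2 ^ (2 * n + 26) * P.K * P.Ω := by ring
  -- branch (i): the Siegel term
  obtain ⟨a, ha⟩ : ∃ a : ℝ, a = 24 * Cb ^ n * P.Ω * P.K * P.yloadG / (P.G * P.g ^ n) := ⟨_, rfl⟩
  have ha0 : 0 ≤ a := by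
    rw [ha]; have : 0 ≤ P.yloadG := P.yloadG_pos.le; positivity
  have ha1 : a ≤ 264 * Cb ^ n * P.Ω * P.K := by
    rw [ha, div_le_iff₀ (by positivity)]
    calc 24 * Cb ^ n * P.Ω * P.K * P.yloadG ≤ 24 * Cb ^ n * P.Ω * P.K * (11 * P.G) :=
          mul_le_mul_of_nonneg_left hy (by positivity)
      _ = 264 * Cb ^ n * P.Ω * P.K * (P.G * 1) := by ring
      _ ≤ 264 * Cb ^ n * P.Ω * P.K * (P.G * P.g ^ n) := by gcongr
  have hb1 : (⌈a⌉₊ : ℝ) ≤ (264 * Cb ^ n + 2 ^ (2 * n + 26)) * P.K * P.Ω := by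
    have hc1 : (⌈a⌉₊ : ℝ) ≤ a + 1 := (Nat.ceil_lt_add_one ha0).le
    rw [eR]; linarith
  -- branch (ii): `2^{n+25}`
  have hb2 : ((2 : ℝ) ^ (n + 25)) ≤ (264 * Cb ^ n + 2 ^ (2 * n + 26)) * P.K * P.Ω := by
    have h1 : (2 : ℝ) ^ (n + 25) ≤ 2 ^ (2 * n + 26) := pow_le_pow_right₀ (by norm_num) (by omega)
    have h2 : (2 : ℝ) ^ (2 * n + 26) ≤ 2 ^ (2 * n + 26) * P.K * P.Ω := by
      rw [mul_assoc]; exact le_mul_of_one_le_right (by positivity) hKΩ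
    have h3 : (0 : ℝ) ≤ 264 * Cb ^ n * P.Ω * P.K := by positivity
    rw [eR]; linarith
  -- branch (iii): `⌈(2Amax+1)/g⌉`
  have hb3 : (⌈(2 * P.Amax + 1) / P.g⌉₊ : ℝ) ≤ (264 * Cb ^ n + 2 ^ (2 * n + 26)) * P.K * P.Ω := by
    have hAmax0 : 0 ≤ P.Amax := by linarith [P.hAmax1]
    have h0 : 0 ≤ (2 * P.Amax + 1) / P.g := by positivity
    have hc : (⌈(2 * P.Amax + 1) / P.g⌉₊ : ℝ) ≤ (2 * P.Amax + 1) / P.g + 1 := (Nat.ceil_lt_add_one h0).le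
    have hd : (2 * P.Amax + 1) / P.g ≤ 2 * P.Amax + 1 := div_le_self (by positivity) hg1
    have h1 : 2 * P.Amax ≤ 2 ^ (n + 1) * P.K * P.Ω := by
      calc 2 * P.Amax ≤ 2 * (2 ^ n * P.Ω) := by linarith
        _ = 2 ^ (n + 1) * 1 * P.Ω := by rw [pow_succ]; ring
        _ ≤ 2 ^ (n + 1) * P.K * P.Ω :=
            mul_le_mul_of_nonneg_right (mul_le_mul_of_nonneg_left hK1 (by positivity)) hΩ.le
    have hf : (2 : ℝ) ^ (n + 1) * P.K * P.Ω + 2 * (P.K * P.Ω) ≤ 2 ^ (2 * n + 26) * P.K * P.Ω := by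
      have h4 : (2 : ℝ) ^ (n + 1) ≤ 2 ^ (2 * n + 25) := pow_le_pow_right₀ (by norm_num) (by omega)
      have h5 : (2 : ℝ) ≤ 2 ^ (2 * n + 25) := by
        calc (2 : ℝ) = 2 ^ 1 := by norm_num
          _ ≤ 2 ^ (2 * n + 25) := pow_le_pow_right₀ (by norm_num) (by omega)
      have e : (2 : ℝ) ^ (2 * n + 26) = 2 ^ (2 * n + 25) + 2 ^ (2 * n + 25) := by rw [pow_succ]; ring
      have hKΩ0 : (0 : ℝ) ≤ P.K * P.Ω := by positivity
      have h6 := mul_le_mul_of_nonneg_right h4 hKΩ0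
      have h7 := mul_le_mul_of_nonneg_right h5 hKΩ0
      rw [e]
      have e2 : (2 : ℝ) ^ (n + 1) * P.K * P.Ω = 2 ^ (n + 1) * (P.K * P.Ω) := by ring
      have e3 : ((2 : ℝ) ^ (2 * n + 25) + 2 ^ (2 * n + 25)) * P.K * P.Ω =
          2 ^ (2 * n + 25) * (P.K * P.Ω) + 2 ^ (2 * n + 25) * (P.K * P.Ω) := by ring
      rw [e2, e3]; linarith
    have h3 : (0 : ℝ) ≤ 264 * Cb ^ n * P.Ω * P.K := by positivity
    rw [eR]; linarith
  -- branch (iv): `4(ŜG+2)`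
  have hb4 : ((4 * (P.SdG + 2) : ℕ) : ℝ) ≤ (264 * Cb ^ n + 2 ^ (2 * n + 26)) * P.K * P.Ω := by
    have h2 : ((4 * (P.SdG + 2) : ℕ) : ℝ) ≤ (2 : ℝ) ^ (n + 8) * P.K := by
      exact_mod_cast P.four_SdG_le_pow_mul_K hNqK hgK
    have h3 : (2 : ℝ) ^ (n + 8) ≤ 2 ^ (2 * n + 26) := pow_le_pow_right₀ (by norm_num) (by omega)
    have h4 : (2 : ℝ) ^ (n + 8) * P.K ≤ 2 ^ (2 * n + 26) * P.K * P.Ω := by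
      calc (2 : ℝ) ^ (n + 8) * P.K ≤ 2 ^ (2 * n + 26) * P.K := by gcongr
        _ = 2 ^ (2 * n + 26) * P.K * 1 := (mul_one _).symm
        _ ≤ 2 ^ (2 * n + 26) * P.K * P.Ω := by gcongr
    have h5 : (0 : ℝ) ≤ 264 * Cb ^ n * P.Ω * P.K := by positivity
    rw [eR]; linarith
  have hL : (P.LgV : ℝ) = max (max (⌈a⌉₊ : ℝ) ((2 : ℝ) ^ (n + 25)))
      (max (⌈(2 * P.Amax + 1) / P.g⌉₊ : ℝ) ((4 * (P.SdG + 2) : ℕ) : ℝ)) := by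
    unfold LgV; rw [ha]; push_cast; rfl
  rw [hL]
  exact max_le (max_le hb1 hb2) (max_le hb3 hb4)

/-! ### The frame's END range slot `⌊2ⁿ·XsV ŜG/(2(n+1))⌋` -/

/-- `XsV ŜG ≤ 2·⌊2ⁿ·XsV ŜG/(2(n+1))⌋ + 1` for every `n ≥ 1` (`(n+1)·Y ≤ 2ⁿ·Y < (2(n+1))·(q+1)`). [folklore] -/
theorem XsV_SdG_le_two_mul_add_one : P.XsV P.SdG ≤ 2 * (2 ^ n * P.XsV P.SdG / (2 * (n + 1))) + 1 := by
  have h2 : n + 1 ≤ 2 ^ n := Nat.succ_le_of_lt Nat.lt_two_pow_self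
  generalize P.XsV P.SdG = Y
  have h1 : 2 ^ n * Y < 2 ^ n * Y / (2 * (n + 1)) * (2 * (n + 1)) + 2 * (n + 1) :=
    Nat.lt_div_mul_add (by positivity)
  generalize 2 ^ n * Y / (2 * (n + 1)) = q at h1 ⊢
  have h3 : (n + 1) * Y ≤ 2 ^ n * Y := Nat.mul_le_mul_right Y h2
  rcases Nat.lt_or_ge Y (2 * q + 2) with h | h
  · omega
  · exfalso
    have h4 := Nat.mul_le_mul_left (n + 1) h
    have e1 : (n + 1) * (2 * q + 2) = q * (2 * (n + 1)) + 2 * (n + 1) := by ring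
    rw [e1] at h4
    exact lt_irrefl _ (lt_of_le_of_lt (h4.trans h3) h1)

/-- `2·((n+1)·⌊2ⁿ·XsV ŜG/(2(n+1))⌋) ≤ 2ⁿ·XsV ŜG` (the frame's even-points constraint). [folklore] -/
theorem two_mul_XfinO_le : 2 * ((n + 1) * (2 ^ n * P.XsV P.SdG / (2 * (n + 1)))) ≤ 2 ^ n * P.XsV P.SdG := by
  rw [← mul_assoc, mul_comm]
  exact Nat.div_mul_le_self _ _

end PadicG3Par

end Summit.ABC.StewartYu

end
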